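import Summits.NavierStokesRegularity.NavierStokesRegularity.Theses.TautLoopKelvin

/-!
# Loop-space tools for the crux `TautCompressionIntegrable` (negative side), part 1/4

Negative-side support for the crux `TautLoopKelvin.TautCompressionIntegrable`
(stmt-NavierStokesRegularity-15248, route `TautLoopKelvin`, rank 2), cdisprove seat, 2026-08-17. This
file: the crux's loop-space functionals written as definitions that unfold VERBATIM to the crux's
expressions at a slice (`len`, `rate`, `ell`, `tautSet`, `nearTautRate`), junk-robust static lemmas
(`|∮v| ≤ sup|v|·length`, gradients have zero circulation, `k(γ;v) ≤ sup‖Dv‖`, rate sets bounded, a lower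
bound of `Λ_g` by one taut loop), the frame / rotation generator `J` / Burgers strain `S` on `ℝ³`, and
the unit circle `γ₁`. Used by `SwirlStrainProfile`, `SwirlStrainCalibration`, `FalseWithoutMomentum`.
Theorems and explicit objects only; nothing here asserts a Theses statement.
-/

noncomputable section

namespace Summit.NavierStokesRegularity.NavierStokesRegularity.Theorems.TautCompressionIntegrable.Negative

open MeasureTheory Set Filter Metric Real intervalIntegral InnerProductSpace
open scoped ENNReal RealInnerProductSpace ContDiff Topology
open Literature.Analysis.FluidPDE

set_option linter.dupNamespace false

local notation "ℝ³" => EuclideanSpace ℝ (Fin 3)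

/-! ## The loop-space functionals of the crux (verbatim) -/

/-- Length of a loop read on `[0, 1]`. -/
def len (γ : ℝ → ℝ³) : ℝ := ∫ σ in (0:ℝ)..1, ‖deriv γ σ‖

/-- Mean tangential compression rate `k(γ; v)` of the field `v` along `γ` — verbatim the crux's `k`. -/
def rate (v : ℝ³ → ℝ³) (γ : ℝ → ℝ³) : ℝ :=
  (∫ σ in (0:ℝ)..1, -(inner ℝ (deriv γ σ) (fderiv ℝ v (γ σ) (deriv γ σ))) / ‖deriv γ σ‖) /
    (∫ σ in (0:ℝ)..1, ‖deriv γ σ‖)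

/-- The circulation–length spectrum `ℓ(v, g)` (valued in `[0, ∞]`) — verbatim. -/
def ell (v : ℝ³ → ℝ³) (g : ℝ) : ℝ≥0∞ :=
  ⨅ (γ' : ℝ → ℝ³) (_ : IsC1Loop γ' ∧ g ≤ |circulation v γ'|), ENNReal.ofReal (∫ σ in (0:ℝ)..1, ‖deriv γ' σ‖)

/-- The set of compression rates of the `ε`-near-taut admissible loops — verbatim. -/
def tautSet (v : ℝ³ → ℝ³) (g ε : ℝ) : Set ℝ :=
  {k : ℝ | ∃ γ : ℝ → ℝ³, IsC1Loop γ ∧ g ≤ |circulation v γ| ∧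
    ENNReal.ofReal (∫ σ in (0:ℝ)..1, ‖deriv γ σ‖) ≤
      (⨅ (γ' : ℝ → ℝ³) (_ : IsC1Loop γ' ∧ g ≤ |circulation v γ'|),
        ENNReal.ofReal (∫ σ in (0:ℝ)..1, ‖deriv γ' σ‖)) + ENNReal.ofReal ε ∧
    k = ((∫ σ in (0:ℝ)..1, -(inner ℝ (deriv γ σ) (fderiv ℝ v (γ σ) (deriv γ σ))) / ‖deriv γ σ‖) /
      (∫ σ in (0:ℝ)..1, ‖deriv γ σ‖))}

/-- The near-taut compression rate `Λ_g(v)` — verbatim the crux's functional at a slice `v = u s`. -/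
def nearTautRate (v : ℝ³ → ℝ³) (g : ℝ) : ℝ :=
  ⨅ ε : {ε : ℝ // 0 < ε}, sSup (tautSet v g ε)

/-! ## Static loop-space lemmas -/

/-- Lengths are nonnegative. -/
theorem len_nonneg (γ : ℝ → ℝ³) : 0 ≤ len γ :=
  intervalIntegral.integral_nonneg zero_le_one fun _ _ => norm_nonneg _

/-- `|∮_γ v·dl| ≤ sup|v| · length(γ)`. -/
theorem abs_circulation_le {v : ℝ³ → ℝ³} {C : ℝ} (hv : Continuous v) (hC : ∀ x, ‖v x‖ ≤ C)
    {γ : ℝ → ℝ³} (hγ : IsC1Loop γ) : |circulation v γ| ≤ C * len γ := by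
  unfold circulation len
  rw [← intervalIntegral.integral_const_mul]
  refine (intervalIntegral.abs_integral_le_integral_abs zero_le_one).trans ?_
  refine intervalIntegral.integral_mono_on zero_le_one ?_ ?_ (fun σ _ => ?_)
  · exact ((hv.comp hγ.continuous).inner hγ.continuous_deriv).abs.intervalIntegrable 0 1
  · exact (continuous_const.mul hγ.continuous_deriv.norm).intervalIntegrable 0 1
  · exact (abs_real_inner_le_norm _ _).trans (mul_le_mul_of_nonneg_right (hC _) (norm_nonneg _))

/-- Gradient fields have zero circulation around closed `C¹` loops (fundamental theorem of calculus). -/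
theorem circulation_gradient_eq_zero {ψ : ℝ³ → ℝ} (hψ : ContDiff ℝ 1 ψ) {γ : ℝ → ℝ³}
    (hγ : IsC1Loop γ) : circulation (gradient ψ) γ = 0 := by
  unfold circulation
  have hderiv : ∀ s ∈ uIcc (0:ℝ) 1,
      HasDerivAt (fun s => ψ (γ s)) ⟪gradient ψ (γ s), deriv γ s⟫ s := by
    intro s _
    have h1 : HasFDerivAt ψ (fderiv ℝ ψ (γ s)) (γ s) :=
      ((hψ.differentiable one_ne_zero) (γ s)).hasFDerivAt
    have h2 := h1.comp_hasDerivAt s (hγ.differentiable s).hasDerivAt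
    refine h2.congr_deriv ?_
    rw [gradient, InnerProductSpace.toDual_symm_apply]
  have hcont : Continuous (gradient ψ) := by
    show Continuous fun x => (InnerProductSpace.toDual ℝ ℝ³).symm (fderiv ℝ ψ x)
    exact (InnerProductSpace.toDual ℝ ℝ³).symm.continuous.comp (hψ.continuous_fderiv one_ne_zero)
  rw [integral_eq_sub_of_hasDerivAt hderiv
    (((hcont.comp hγ.continuous).inner hγ.continuous_deriv).intervalIntegrable 0 1)]
  rw [hγ.apply_zero_eq_apply_one, sub_self]

/-- **Static bound** `k(γ; v) ≤ L` for every `C¹` loop when `‖Dv‖ ≤ L` pointwise (junk-robust: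
`x / 0 = 0`). -/
theorem rate_le_of_norm_fderiv_le {v : ℝ³ → ℝ³} {L : ℝ} (hL0 : 0 ≤ L)
    (hL : ∀ x, ‖fderiv ℝ v x‖ ≤ L) {γ : ℝ → ℝ³} (hγ : IsC1Loop γ) : rate v γ ≤ L := by
  unfold rate
  have hpt : ∀ σ, ‖-(⟪deriv γ σ, fderiv ℝ v (γ σ) (deriv γ σ)⟫) / ‖deriv γ σ‖‖ ≤ L * ‖deriv γ σ‖ := by
    intro σ
    rw [norm_div, norm_neg, norm_norm, Real.norm_eq_abs]
    by_cases h0 : deriv γ σ = 0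
    · simp [h0]
    · rw [div_le_iff₀ (norm_pos_iff.2 h0)]
      calc |⟪deriv γ σ, fderiv ℝ v (γ σ) (deriv γ σ)⟫|
          ≤ ‖deriv γ σ‖ * ‖fderiv ℝ v (γ σ) (deriv γ σ)‖ := abs_real_inner_le_norm _ _
        _ ≤ ‖deriv γ σ‖ * (L * ‖deriv γ σ‖) := by
            gcongr
            exact (ContinuousLinearMap.le_opNorm _ _).trans
              (mul_le_mul_of_nonneg_right (hL _) (norm_nonneg _))
        _ = L * ‖deriv γ σ‖ * ‖deriv γ σ‖ := by ring
  have hnum : ‖∫ σ in (0:ℝ)..1, -(⟪deriv γ σ, fderiv ℝ v (γ σ) (deriv γ σ)⟫) / ‖deriv γ σ‖‖ ≤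
      ∫ σ in (0:ℝ)..1, L * ‖deriv γ σ‖ :=
    intervalIntegral.norm_integral_le_of_norm_le zero_le_one (ae_of_all _ fun σ _ => hpt σ)
      ((continuous_const.mul hγ.continuous_deriv.norm).intervalIntegrable 0 1)
  rw [intervalIntegral.integral_const_mul] at hnum
  rcases (len_nonneg γ).eq_or_lt with h0 | hpos
  · unfold len at h0
    rw [← h0, div_zero]
    exact hL0
  · unfold len at hpos
    rw [div_le_iff₀ hpos]
    exact (Real.le_norm_self _).trans hnum

/-- The near-taut rate sets are bounded above by any pointwise bound of `‖Dv‖`. -/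
theorem bddAbove_tautSet {v : ℝ³ → ℝ³} {L : ℝ} (hL0 : 0 ≤ L) (hL : ∀ x, ‖fderiv ℝ v x‖ ≤ L)
    (g ε : ℝ) : BddAbove (tautSet v g ε) := by
  refine ⟨L, fun k hk => ?_⟩
  obtain ⟨γ, hγ, -, -, hk⟩ := hk
  rw [hk]
  exact rate_le_of_norm_fderiv_le hL0 hL hγ

/-- **Lower bound for `Λ_g(v)` by one taut loop**: if the rate sets are bounded above and `γ₀` is an
admissible loop of minimal length (`ofReal (len γ₀) ≤ ℓ`), then `k(γ₀; v) ≤ Λ_g(v)`. -/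
theorem rate_le_nearTautRate {v : ℝ³ → ℝ³} {g : ℝ} {γ₀ : ℝ → ℝ³}
    (hbdd : ∀ ε : ℝ, 0 < ε → BddAbove (tautSet v g ε))
    (h₀ : IsC1Loop γ₀) (hadm : g ≤ |circulation v γ₀|)
    (htaut : ENNReal.ofReal (len γ₀) ≤ ell v g) :
    rate v γ₀ ≤ nearTautRate v g := by
  unfold nearTautRate
  haveI : Nonempty {ε : ℝ // 0 < ε} := ⟨⟨1, one_pos⟩⟩
  refine le_ciInf fun ε => ?_
  refine le_csSup (hbdd ε.1 ε.2) ⟨γ₀, h₀, hadm, ?_, rfl⟩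
  exact htaut.trans le_self_add

/-- A uniform lower bound on the lengths of admissible loops bounds `ℓ` from below. -/
theorem ofReal_le_ell {v : ℝ³ → ℝ³} {g c : ℝ}
    (h : ∀ γ : ℝ → ℝ³, IsC1Loop γ → g ≤ |circulation v γ| → c ≤ len γ) :
    ENNReal.ofReal c ≤ ell v g :=
  le_iInf₂ fun γ hγ => ENNReal.ofReal_le_ofReal (h γ hγ.1 hγ.2)

/-- Length of a dilated loop. -/
theorem len_const_smul {γ : ℝ → ℝ³} (hγ : IsC1Loop γ) {c : ℝ} (hc : 0 ≤ c) :
    len (fun σ => c • γ σ) = c * len γ := by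
  unfold len
  rw [← intervalIntegral.integral_const_mul]
  refine intervalIntegral.integral_congr fun σ _ => ?_
  show ‖deriv (c • γ) σ‖ = c * ‖deriv γ σ‖
  rw [deriv_const_smul c (hγ.differentiable σ), norm_smul, Real.norm_eq_abs, abs_of_nonneg hc]

/-! ## Linear algebra on `ℝ³`: the frame, the rotation generator, the strain -/

/-- `e₀ = (1, 0, 0)`. -/
def e0 : ℝ³ := EuclideanSpace.single 0 1

/-- `e₁ = (0, 1, 0)`. -/
def e1 : ℝ³ := EuclideanSpace.single 1 1

/-- `e₂ = (0, 0, 1)`. -/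
def e2 : ℝ³ := EuclideanSpace.single 2 1

/-- The rotation generator `J x = e₂ × x = (−x₁, x₀, 0)`. -/
def Jrot : ℝ³ →L[ℝ] ℝ³ :=
  (EuclideanSpace.proj (0 : Fin 3) : ℝ³ →L[ℝ] ℝ).smulRight e1 -
    (EuclideanSpace.proj (1 : Fin 3) : ℝ³ →L[ℝ] ℝ).smulRight e0

/-- The axisymmetric (Burgers) strain `S x = (−x₀, −x₁, 2x₂)`: symmetric, trace free, contracting the
horizontal plane at unit rate. -/
def Sst : ℝ³ →L[ℝ] ℝ³ :=
  -ContinuousLinearMap.id ℝ ℝ³ + (3 : ℝ) • (EuclideanSpace.proj (2 : Fin 3) : ℝ³ →L[ℝ] ℝ).smulRight e2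

/-- Coordinates of `J x = (−x₁, x₀, 0)`. -/
@[simp] theorem Jrot_apply_zero (x : ℝ³) : Jrot x 0 = -x 1 := by
  simp [Jrot, e0, e1]

/-- Coordinates of `J x = (−x₁, x₀, 0)`. -/
@[simp] theorem Jrot_apply_one (x : ℝ³) : Jrot x 1 = x 0 := by
  simp [Jrot, e0, e1]

/-- Coordinates of `J x = (−x₁, x₀, 0)`. -/
@[simp] theorem Jrot_apply_two (x : ℝ³) : Jrot x 2 = 0 := by
  simp [Jrot, e0, e1]

/-- Coordinates of `S x = (−x₀, −x₁, 2x₂)`. -/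
@[simp] theorem Sst_apply_zero (x : ℝ³) : Sst x 0 = -x 0 := by
  simp [Sst, e2]

/-- Coordinates of `S x = (−x₀, −x₁, 2x₂)`. -/
@[simp] theorem Sst_apply_one (x : ℝ³) : Sst x 1 = -x 1 := by
  simp [Sst, e2]

/-- Coordinates of `S x = (−x₀, −x₁, 2x₂)`. -/
@[simp] theorem Sst_apply_two (x : ℝ³) : Sst x 2 = 2 * x 2 := by
  simp [Sst, e2]
  ring

/-- `⟪y, J y⟫ = 0`. -/
theorem inner_Jrot_self (y : ℝ³) : ⟪y, Jrot y⟫ = 0 := by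
  simp only [PiLp.inner_apply, Fin.sum_univ_three, RCLike.inner_apply, conj_trivial,
    Jrot_apply_zero, Jrot_apply_one, Jrot_apply_two]
  ring

/-- `‖J x‖² = x₀² + x₁²`. -/
theorem norm_Jrot_sq (x : ℝ³) : ‖Jrot x‖ ^ 2 = x 0 ^ 2 + x 1 ^ 2 := by
  rw [EuclideanSpace.norm_sq_eq]
  simp only [Fin.sum_univ_three, Real.norm_eq_abs, sq_abs, Jrot_apply_zero, Jrot_apply_one,
    Jrot_apply_two]
  ring

/-- `‖x‖² = x₀² + x₁² + x₂²`. -/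
theorem norm_sq_eq_three (x : ℝ³) : ‖x‖ ^ 2 = x 0 ^ 2 + x 1 ^ 2 + x 2 ^ 2 := by
  rw [EuclideanSpace.norm_sq_eq]
  simp only [Fin.sum_univ_three, Real.norm_eq_abs, sq_abs]

/-! ## The unit circle `γ₁` in the horizontal plane -/

/-- The unit circle in the plane of `(e₀, e₁)` about the origin, parametrised `1`-periodically. -/
def γ₁ : ℝ → ℝ³ := circleLoop 0 1 e0 e1

/-- The unit circle is a closed `C¹` loop. -/
theorem isC1Loop_γ₁ : IsC1Loop γ₁ := isC1Loop_circleLoop 0 1 e0 e1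

/-- The unit circle in the frame `(e₀, e₁)`. -/
theorem γ₁_apply (s : ℝ) : γ₁ s = (cos (2 * π * s)) • e0 + (sin (2 * π * s)) • e1 := by
  simp [γ₁, circleLoop]

/-- Coordinates of the unit circle. -/
@[simp] theorem γ₁_apply_zero (s : ℝ) : γ₁ s 0 = cos (2 * π * s) := by
  simp [γ₁_apply, e0, e1]

/-- Coordinates of the unit circle. -/
@[simp] theorem γ₁_apply_one (s : ℝ) : γ₁ s 1 = sin (2 * π * s) := by
  simp [γ₁_apply, e0, e1]

/-- Coordinates of the unit circle (it is horizontal). -/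
@[simp] theorem γ₁_apply_two (s : ℝ) : γ₁ s 2 = 0 := by
  simp [γ₁_apply, e0, e1]

/-- `γ₁' = 2π J γ₁`. -/
theorem deriv_γ₁ (s : ℝ) : deriv γ₁ s = (2 * π) • Jrot (γ₁ s) := by
  rw [γ₁, deriv_circleLoop]
  congr 1
  ext i
  fin_cases i <;> simp [e0, e1, circleLoop]

/-- Velocity of the unit circle. -/
theorem hasDerivAt_γ₁ (s : ℝ) : HasDerivAt γ₁ ((2 * π) • Jrot (γ₁ s)) s := by
  rw [← deriv_γ₁]
  exact (isC1Loop_γ₁.differentiable s).hasDerivAt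

/-- `‖J γ₁(s)‖ = 1`. -/
theorem norm_Jrot_γ₁ (s : ℝ) : ‖Jrot (γ₁ s)‖ = 1 := by
  have h : ‖Jrot (γ₁ s)‖ ^ 2 = 1 := by
    rw [norm_Jrot_sq, γ₁_apply_zero, γ₁_apply_one, cos_sq_add_sin_sq]
  have h0 : 0 ≤ ‖Jrot (γ₁ s)‖ := norm_nonneg _
  nlinarith [h, h0]

/-- `‖γ₁'‖ = 2π`. -/
theorem norm_deriv_γ₁ (s : ℝ) : ‖deriv γ₁ s‖ = 2 * π := by
  rw [deriv_γ₁, norm_smul, norm_Jrot_γ₁, mul_one, Real.norm_eq_abs, abs_of_pos two_pi_pos]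

/-- `‖γ₁(s)‖ = 1`. -/
theorem norm_γ₁ (s : ℝ) : ‖γ₁ s‖ = 1 := by
  have h : ‖γ₁ s‖ ^ 2 = 1 := by
    rw [norm_sq_eq_three, γ₁_apply_zero, γ₁_apply_one, γ₁_apply_two, cos_sq_add_sin_sq]
    ring
  have h0 : 0 ≤ ‖γ₁ s‖ := norm_nonneg _
  nlinarith [h, h0]

/-- The length of the unit circle is `2π`. -/
theorem len_γ₁ : len γ₁ = 2 * π := by
  unfold len
  simp_rw [norm_deriv_γ₁]
  simp

/-- The strain acts as `−id` on horizontal vectors: `S γ₁' = −γ₁'`. -/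
theorem Sst_deriv_γ₁ (s : ℝ) : Sst (deriv γ₁ s) = -deriv γ₁ s := by
  ext i
  fin_cases i <;> simp [deriv_γ₁]

/-- `J x = −x₁ e₀ + x₀ e₁`. -/
theorem Jrot_eq (x : ℝ³) : Jrot x = (-x 1) • e0 + (x 0) • e1 := by
  ext i
  fin_cases i <;> simp [e0, e1]

end Summit.NavierStokesRegularity.NavierStokesRegularity.Theorems.TautCompressionIntegrable.Negative

end
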